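import Literature.Computability.Complexity.RowSelectFP
import Literature.Computability.Cryptography.RegevSamplerArith
import HarnessLib

/-!
# Regev 2009, Lemma 3.14 in machine form: the classical stage's integer arithmetic is polynomial time

Topic `Computability/Cryptography` (family `pqc`), grouping namespace `Regev2009.SamplerArithFP`; the
machine side of `RegevSamplerArith.lean` (the exact integer arithmetic `aVec`, `latPart`, `ytil`, `sNat`,
`recover` of the sampler's classical stage: branch, residues, erasure). Each map is written as a LIST
PROGRAM over the row list `rows B` of the basis (`Berkowitz.rows`), the row list `rows Bᵀ` of its
transpose, `|det B|`, `sign(det B)` and `R` — data the circuit generator precomputes once — and run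
on codes (`zmatE = rawE (rawE intE)`, `ivecE = rawE intE`) by the typed combinators of `CodeFP*.lean`
with the polynomial-time determinant `IntDetFP.detZ` of `DeterminantFP.lean` (Cramer's rule: the
`i`-th entry of `adj(B) u` is `det` of `Bᵀ` with row `i` replaced by `u`):

* programs `mulVecL`, `divL`, `aVecL`, `cramerL`, `smulL`, `subL`, `addL`, `latPartL`, `ytilL`,
  `sNatL`, `mixL` (`(s, c) ↦ s − R·c`), `recoverL`;
* their values on genuine data (`mulVecL_rows`, `cramerL_rows`, **`aVecL_eq`**, **`latPartL_eq`**,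
  **`ytilL_eq`**, **`sNatL_eq`**, **`recoverL_eq`**: the list programs compute `List.ofFn` of the maps of
  `RegevSamplerArith`);
* their `CodeFP` facts (`codeFP_mulVecL`, …, **`codeFP_ytilL`**, **`codeFP_sNatL`**, **`codeFP_recoverL`**).

Everything is proved; definitions have bodies; no named fact is introduced.

## References

* O. Regev, *On lattices, learning with errors, random linear codes, and cryptography*, J. ACM 56
  (2009), art. 34; author's version arXiv:2401.03703: Lemma 3.14 (proof), §2 p. 11 [Regev2009].
* S. Arora, B. Barak, *Computational Complexity: A Modern Approach*, CUP 2009, §1.3 (closure of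
  polynomial time under composition and bounded loops) [AroraBarak2009].
* D. Micciancio, S. Goldwasser, *Complexity of Lattice Problems*, Kluwer 2002, Ch. 1 §1.1 (Cramer's rule)
  [MicciancioGoldwasser2002].
-/

noncomputable section

namespace Literature.Computability.Cryptography

namespace Regev2009

namespace SamplerArithFP

open Literature.Algebra.EuclideanLattices Literature.Computability.Complexity
  Literature.Computability.Complexity.CodeFP Literature.LinearAlgebra.Matrix
  Literature.LinearAlgebra.Matrix.Berkowitz Literature.LinearAlgebra.Matrix.RowSelect IntDetFP SamplerArith Matrix
open _root_.Computability

/-- Integer vectors: raw lists of canonical integer codes. -/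
local notation "ivecE" => rawE intE

/-- Integer matrices: raw lists of rows. -/
local notation "zmatE" => rawE (rawE intE)

/-! ### The list programs -/

/-- `A x` for a row list `A`. [folklore] -/
def mulVecL (A : List (List ℤ)) (x : List ℤ) : List ℤ := A.map fun row => idot row x

/-- Entrywise floor division. [folklore] -/
def divL (v : List ℤ) (d : ℤ) : List ℤ := v.map (· / d)

/-- `⌊A x / d⌋`. [cite: Regev2009, Lemma 3.14 (proof)] -/
def aVecL (A : List (List ℤ)) (d : ℤ) (x : List ℤ) : List ℤ := divL (mulVecL A x) d

/-- **Cramer's rule on a row list `At` of the TRANSPOSE**: entry `i` is `det` of `At` with row `i`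
replaced by `u` (`= (adj B u)ᵢ` for `At = rows Bᵀ`). [cite: MicciancioGoldwasser2002, Ch. 1 §1.1] -/
def cramerL (At : List (List ℤ)) (u : List ℤ) : List ℤ := (List.range At.length).map fun i => detZ (At.set i u)

/-- Scalar multiple. [folklore] -/
def smulL (c : ℤ) (v : List ℤ) : List ℤ := v.map (c * ·)

/-- Difference. [folklore] -/
def subL (u v : List ℤ) : List ℤ := List.zipWith (· - ·) u v

/-- Sum. [folklore] -/
def addL (u v : List ℤ) : List ℤ := List.zipWith (· + ·) u v

/-- `sign(det B)·adj(B)⌊a⌋` as a list program. [cite: Regev2009, Lemma 3.14 (proof)] -/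
def latPartL (A At : List (List ℤ)) (d sg : ℤ) (x : List ℤ) : List ℤ := smulL sg (cramerL At (aVecL A d x))

/-- `ỹ = x̃ − latPart`. [cite: Regev2009, Lemma 3.14 (proof)] -/
def ytilL (A At : List (List ℤ)) (d sg : ℤ) (x : List ℤ) : List ℤ := subL x (latPartL A At d sg x)

/-- The residues `⌊a⌋ mod R` (`zmodNat (R−1)`). [cite: Regev2009, Lemma 3.14 (proof)] -/
def sNatL (A : List (List ℤ)) (d : ℤ) (R : ℕ) (x : List ℤ) : List ℕ := (aVecL A d x).map (zmodNat (R - 1))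

/-- `(s, c) ↦ s − R·c` entrywise. [folklore] -/
def mixL (R : ℕ) (s : List ℕ) (c : List ℤ) : List ℤ := List.zipWith (fun (a : ℕ) (b : ℤ) => (a : ℤ) - R * b) s c

/-- `ỹ + sign(det B)·adj(B)(s − R·c)`. [cite: Regev2009, Lemma 3.14 (proof: "recover x")] -/
def recoverL (At : List (List ℤ)) (sg : ℤ) (R : ℕ) (y : List ℤ) (s : List ℕ) (c : List ℤ) : List ℤ :=
  addL y (smulL sg (cramerL At (mixL R s c)))

/-! ### Values on genuine data -/

section Values

variable {n : ℕ}

/-- `zipWith` of two `ofFn` lists. [folklore] -/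
theorem zipWith_ofFn {α β γ : Type*} (f : α → β → γ) (u : Fin n → α) (v : Fin n → β) :
    List.zipWith f (List.ofFn u) (List.ofFn v) = List.ofFn fun i => f (u i) (v i) :=
  List.ext_getElem (by simp) fun i h₁ h₂ => by simp [List.getElem_zipWith]

/-- `mulVecL (rows B) x̃ = B x̃`. [folklore] -/
theorem mulVecL_rows (B : Matrix (Fin n) (Fin n) ℤ) (x : Fin n → ℤ) :
    mulVecL (rows B) (List.ofFn x) = List.ofFn (B *ᵥ x) := by
  unfold mulVecL rows
  rw [List.map_ofFn]
  congr 1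
  funext i
  rw [Function.comp_apply, idot_ofFn]
  rfl

/-- `divL` entrywise. [folklore] -/
theorem divL_ofFn (v : Fin n → ℤ) (d : ℤ) : divL (List.ofFn v) d = List.ofFn fun j => v j / d := by
  unfold divL; rw [List.map_ofFn]; rfl

/-- `smulL` entrywise. [folklore] -/
theorem smulL_ofFn (c : ℤ) (v : Fin n → ℤ) : smulL c (List.ofFn v) = List.ofFn (c • v) := by
  unfold smulL; rw [List.map_ofFn]; rfl

/-- `subL` entrywise. [folklore] -/
theorem subL_ofFn (u v : Fin n → ℤ) : subL (List.ofFn u) (List.ofFn v) = List.ofFn (u - v) := by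
  unfold subL; rw [zipWith_ofFn]; rfl

/-- `addL` entrywise. [folklore] -/
theorem addL_ofFn (u v : Fin n → ℤ) : addL (List.ofFn u) (List.ofFn v) = List.ofFn (u + v) := by
  unfold addL; rw [zipWith_ofFn]; rfl

/-- `mixL` entrywise. [folklore] -/
theorem mixL_ofFn (R : ℕ) (s : Fin n → ℕ) (c : Fin n → ℤ) :
    mixL R (List.ofFn s) (List.ofFn c) = List.ofFn fun j => (s j : ℤ) - R * c j := by
  unfold mixL; rw [zipWith_ofFn]

/-- **`cramerL (rows Bᵀ) u = adj(B) u`** (Cramer). [cite: MicciancioGoldwasser2002, Ch. 1 §1.1] -/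
theorem cramerL_rows (B : Matrix (Fin n) (Fin n) ℤ) (u : Fin n → ℤ) :
    cramerL (rows Bᵀ) (List.ofFn u) = List.ofFn (B.cramer u) := by
  unfold cramerL
  rw [length_rows]
  apply List.ext_getElem (by simp)
  intro i h₁ h₂
  rw [List.length_map, List.length_range] at h₁
  rw [List.getElem_map, List.getElem_range, List.getElem_ofFn]
  have hset := rows_set Bᵀ ⟨i, h₁⟩ u
  simp only at hset
  rw [hset, detZ_rows, cramer_apply, updateRow_transpose, det_transpose]

variable (I : LatticeInstance) (R : ℕ)

/-- **`aVecL` computes `aVec`.** [cite: Regev2009, Lemma 3.14 (proof)] -/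
theorem aVecL_eq (x : Fin I.n → ℤ) : aVecL (rows I.basis) (detA I : ℤ) (List.ofFn x) = List.ofFn (aVec I x) := by
  unfold aVecL
  rw [mulVecL_rows, divL_ofFn]
  rfl

/-- **`latPartL` computes `latPart`.** [cite: Regev2009, Lemma 3.14 (proof)] -/
theorem latPartL_eq (x : Fin I.n → ℤ) :
    latPartL (rows I.basis) (rows I.basisᵀ) (detA I : ℤ) I.basis.det.sign (List.ofFn x) = List.ofFn (latPart I x) := by
  unfold latPartL
  rw [aVecL_eq, cramerL_rows, smulL_ofFn]
  rfl

/-- **`ytilL` computes `ytil`.** [cite: Regev2009, Lemma 3.14 (proof)] -/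
theorem ytilL_eq (x : Fin I.n → ℤ) :
    ytilL (rows I.basis) (rows I.basisᵀ) (detA I : ℤ) I.basis.det.sign (List.ofFn x) = List.ofFn (ytil I x) := by
  unfold ytilL
  rw [latPartL_eq, subL_ofFn]
  rfl

/-- **`sNatL` computes the residues `sNat`** (`1 ≤ R`). [cite: Regev2009, Lemma 3.14 (proof)] -/
theorem sNatL_eq (hR : 1 ≤ R) (x : Fin I.n → ℤ) :
    sNatL (rows I.basis) (detA I : ℤ) R (List.ofFn x) = List.ofFn (sNat I R x) := by
  unfold sNatL
  rw [aVecL_eq, List.map_ofFn]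
  congr 1
  funext j
  rw [Function.comp_apply, zmodNat, sNat]
  congr 2
  push_cast [Nat.cast_sub hR]
  ring

/-- **`recoverL` computes `recover`.** [cite: Regev2009, Lemma 3.14 (proof)] -/
theorem recoverL_eq (y : Fin I.n → ℤ) (s : Fin I.n → ℕ) (c : Fin I.n → ℤ) :
    recoverL (rows I.basisᵀ) I.basis.det.sign R (List.ofFn y) (List.ofFn s) (List.ofFn c) = List.ofFn (recover I R y s c) := by
  unfold recoverL
  rw [mixL_ofFn, cramerL_rows, smulL_ofFn, addL_ofFn]
  rfl

end Values

/-! ### Polynomial time on codes -/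

section Codes

/-- `mulVecL` on codes. [cite: AroraBarak2009, §1.3] -/
theorem codeFP_mulVecL : CodeFP (pairE zmatE ivecE) ivecE (fun p => mulVecL p.1 p.2) := by
  have hg : CodeFP (pairE ivecE ivecE) intE (fun q : List ℤ × List ℤ => idot q.2 q.1) :=
    (RowSelectFP.idot_codeFP.comp ((snd _ _).pair (fst _ _)) :)
  exact ((map hg).comp ((snd _ _).pair (fst _ _))).congr fun _ => rfl

/-- `divL` on codes. [cite: AroraBarak2009, §1.3] -/
theorem codeFP_divL : CodeFP (pairE ivecE intE) ivecE (fun p => divL p.1 p.2) := by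
  have hg : CodeFP (pairE intE intE) intE (fun q : ℤ × ℤ => q.2 / q.1) := (intEDiv.comp ((snd _ _).pair (fst _ _)) :)
  exact ((map hg).comp ((snd _ _).pair (fst _ _))).congr fun _ => rfl

/-- `aVecL` on codes: `((A, d), x) ↦ aVecL A d x`. [cite: AroraBarak2009, §1.3] -/
theorem codeFP_aVecL : CodeFP (pairE (pairE zmatE intE) ivecE) ivecE (fun p => aVecL p.1.1 p.1.2 p.2) := by
  have hA : CodeFP (pairE (pairE zmatE intE) ivecE) zmatE (fun p => p.1.1) := (fst _ _).fst'
  have hd : CodeFP (pairE (pairE zmatE intE) ivecE) intE (fun p => p.1.2) := (fst _ _).snd'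
  have hx : CodeFP (pairE (pairE zmatE intE) ivecE) ivecE (fun p => p.2) := snd _ _
  exact (codeFP_divL.comp ((codeFP_mulVecL.comp (hA.pair hx)).pair hd)).congr fun _ => rfl

/-- `cramerL` on codes. [cite: AroraBarak2009, §1.3] -/
theorem codeFP_cramerL : CodeFP (pairE zmatE ivecE) ivecE (fun p => cramerL p.1 p.2) := by
  -- item `i` (binary) with context `(At, u)`: `detZ (At.set i u)`
  have hg : CodeFP (pairE (pairE zmatE ivecE) natE) intE (fun t => detZ (t.1.1.set t.2 t.1.2)) :=
    (detZ_codeFP.comp ((setAt ivecE).comp ((fst _ _).fst'.pair ((snd _ _).pair (fst _ _).snd'))) :)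
  have hr : CodeFP (pairE zmatE ivecE) (rawE natE) (fun p => List.range p.1.length) :=
    (urange.comp ((ulength ivecE).comp (fst _ _)) :)
  exact ((map hg).comp ((CodeFP.id _).pair hr)).congr fun _ => rfl

/-- `smulL` on codes. [cite: AroraBarak2009, §1.3] -/
theorem codeFP_smulL : CodeFP (pairE intE ivecE) ivecE (fun p => smulL p.1 p.2) :=
  (map (intMul : CodeFP (pairE intE intE) intE (fun q => q.1 * q.2))).congr fun _ => rfl

/-- `subL` on codes. [cite: AroraBarak2009, §1.3] -/
theorem codeFP_subL : CodeFP (pairE ivecE ivecE) ivecE (fun p => subL p.1 p.2) := by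
  have hg : CodeFP (pairE unitE (pairE intE intE)) intE (fun t : Unit × ℤ × ℤ => t.2.1 - t.2.2) := (intSub.comp (snd _ _) :)
  exact ((zipWith hg).comp ((const _ ()).pair (CodeFP.id _))).congr fun _ => rfl

/-- `addL` on codes. [cite: AroraBarak2009, §1.3] -/
theorem codeFP_addL : CodeFP (pairE ivecE ivecE) ivecE (fun p => addL p.1 p.2) := by
  have hg : CodeFP (pairE unitE (pairE intE intE)) intE (fun t : Unit × ℤ × ℤ => t.2.1 + t.2.2) := (intAdd.comp (snd _ _) :)
  exact ((zipWith hg).comp ((const _ ()).pair (CodeFP.id _))).congr fun _ => rfl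

/-- The parameter code `((A, At), (d, sg))`. [folklore] -/
abbrev parE : (List (List ℤ) × List (List ℤ)) × (ℤ × ℤ) → List Bool := pairE (pairE zmatE zmatE) (pairE intE intE)

/-- The parameter type. [folklore] -/
abbrev Par : Type := (List (List ℤ) × List (List ℤ)) × (ℤ × ℤ)

/-- `latPartL` on codes: `(P, x) ↦ latPartL A At d sg x`. [cite: Regev2009, Lemma 3.14 (proof)] [cite: AroraBarak2009, §1.3] -/
theorem codeFP_latPartL : CodeFP (pairE parE ivecE) ivecE (fun p : Par × List ℤ => latPartL p.1.1.1 p.1.1.2 p.1.2.1 p.1.2.2 p.2) := by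
  have hA : CodeFP (pairE parE ivecE) zmatE (fun p : Par × List ℤ => p.1.1.1) := (fst _ _).fst'.fst'
  have hAt : CodeFP (pairE parE ivecE) zmatE (fun p : Par × List ℤ => p.1.1.2) := (fst _ _).fst'.snd'
  have hd : CodeFP (pairE parE ivecE) intE (fun p : Par × List ℤ => p.1.2.1) := (fst _ _).snd'.fst'
  have hsg : CodeFP (pairE parE ivecE) intE (fun p : Par × List ℤ => p.1.2.2) := (fst _ _).snd'.snd'
  have hx : CodeFP (pairE parE ivecE) ivecE (fun p : Par × List ℤ => p.2) := snd _ _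
  have ha : CodeFP (pairE parE ivecE) ivecE (fun p : Par × List ℤ => aVecL p.1.1.1 p.1.2.1 p.2) :=
    (codeFP_aVecL.comp ((hA.pair hd).pair hx) :)
  have hc : CodeFP (pairE parE ivecE) ivecE (fun p : Par × List ℤ => cramerL p.1.1.2 (aVecL p.1.1.1 p.1.2.1 p.2)) :=
    (codeFP_cramerL.comp (hAt.pair ha) :)
  exact (codeFP_smulL.comp (hsg.pair hc)).congr fun _ => rfl

/-- **`ytilL` on codes.** [cite: Regev2009, Lemma 3.14 (proof)] [cite: AroraBarak2009, §1.3] -/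
theorem codeFP_ytilL : CodeFP (pairE parE ivecE) ivecE (fun p : Par × List ℤ => ytilL p.1.1.1 p.1.1.2 p.1.2.1 p.1.2.2 p.2) :=
  (codeFP_subL.comp ((snd _ _).pair codeFP_latPartL)).congr fun _ => rfl

/-- **`sNatL` on codes**: `((P, R), x) ↦ sNatL A d R x`. [cite: Regev2009, Lemma 3.14 (proof)] [cite: AroraBarak2009, §1.3] -/
theorem codeFP_sNatL : CodeFP (pairE (pairE parE natE) ivecE) (rawE natE) (fun p : (Par × ℕ) × List ℤ => sNatL p.1.1.1.1 p.1.1.2.1 p.1.2 p.2) := by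
  have hA : CodeFP (pairE (pairE parE natE) ivecE) zmatE (fun p : (Par × ℕ) × List ℤ => p.1.1.1.1) := (fst _ _).fst'.fst'.fst'
  have hd : CodeFP (pairE (pairE parE natE) ivecE) intE (fun p : (Par × ℕ) × List ℤ => p.1.1.2.1) := (fst _ _).fst'.snd'.fst'
  have hR : CodeFP (pairE (pairE parE natE) ivecE) natE (fun p : (Par × ℕ) × List ℤ => p.1.2) := (fst _ _).snd'
  have hx : CodeFP (pairE (pairE parE natE) ivecE) ivecE (fun p : (Par × ℕ) × List ℤ => p.2) := snd _ _
  have ha : CodeFP (pairE (pairE parE natE) ivecE) ivecE (fun p : (Par × ℕ) × List ℤ => aVecL p.1.1.1.1 p.1.1.2.1 p.2) :=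
    (codeFP_aVecL.comp ((hA.pair hd).pair hx) :)
  have hR1 : CodeFP (pairE (pairE parE natE) ivecE) natE (fun p : (Par × ℕ) × List ℤ => p.1.2 - 1) :=
    (natSub.comp (hR.pair (const _ (1 : ℕ))) :)
  have hg : CodeFP (pairE natE intE) natE (fun q : ℕ × ℤ => zmodNat q.1 q.2) := zmodNat_codeFP
  exact ((map hg).comp (hR1.pair ha)).congr fun _ => rfl

/-- `mixL` on codes: `(R, (s, c)) ↦ mixL R s c`. [cite: AroraBarak2009, §1.3] -/
theorem codeFP_mixL : CodeFP (pairE natE (pairE (rawE natE) ivecE)) ivecE (fun p => mixL p.1 p.2.1 p.2.2) := by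
  have hg : CodeFP (pairE natE (pairE natE intE)) intE (fun t : ℕ × ℕ × ℤ => (t.2.1 : ℤ) - t.1 * t.2.2) :=
    (intSub.comp ((intOfNat.comp (snd _ _).fst').pair (intMul.comp ((intOfNat.comp (fst _ _)).pair (snd _ _).snd'))) :)
  exact (zipWith hg).congr fun _ => rfl

/-- **`recoverL` on codes**: `(((At, sg), R), (y, (s, c))) ↦ recoverL At sg R y s c`.
[cite: Regev2009, Lemma 3.14 (proof: "recover x")] [cite: AroraBarak2009, §1.3] -/
theorem codeFP_recoverL : CodeFP (pairE (pairE (pairE zmatE intE) natE) (pairE ivecE (pairE (rawE natE) ivecE))) ivecE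
    (fun p => recoverL p.1.1.1 p.1.1.2 p.1.2 p.2.1 p.2.2.1 p.2.2.2) := by
  have hAt : CodeFP (pairE (pairE (pairE zmatE intE) natE) (pairE ivecE (pairE (rawE natE) ivecE))) zmatE (fun p => p.1.1.1) :=
    (fst _ _).fst'.fst'
  have hsg : CodeFP (pairE (pairE (pairE zmatE intE) natE) (pairE ivecE (pairE (rawE natE) ivecE))) intE (fun p => p.1.1.2) :=
    (fst _ _).fst'.snd'
  have hR : CodeFP (pairE (pairE (pairE zmatE intE) natE) (pairE ivecE (pairE (rawE natE) ivecE))) natE (fun p => p.1.2) :=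
    (fst _ _).snd'
  have hy : CodeFP (pairE (pairE (pairE zmatE intE) natE) (pairE ivecE (pairE (rawE natE) ivecE))) ivecE (fun p => p.2.1) :=
    (snd _ _).fst'
  have hsc : CodeFP (pairE (pairE (pairE zmatE intE) natE) (pairE ivecE (pairE (rawE natE) ivecE))) (pairE (rawE natE) ivecE)
      (fun p => p.2.2) := (snd _ _).snd'
  have hm : CodeFP (pairE (pairE (pairE zmatE intE) natE) (pairE ivecE (pairE (rawE natE) ivecE))) ivecE
      (fun p => mixL p.1.2 p.2.2.1 p.2.2.2) := (codeFP_mixL.comp (hR.pair hsc) :)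
  have hc : CodeFP (pairE (pairE (pairE zmatE intE) natE) (pairE ivecE (pairE (rawE natE) ivecE))) ivecE
      (fun p => cramerL p.1.1.1 (mixL p.1.2 p.2.2.1 p.2.2.2)) := (codeFP_cramerL.comp (hAt.pair hm) :)
  have hs : CodeFP (pairE (pairE (pairE zmatE intE) natE) (pairE ivecE (pairE (rawE natE) ivecE))) ivecE
      (fun p => smulL p.1.1.2 (cramerL p.1.1.1 (mixL p.1.2 p.2.2.1 p.2.2.2))) := (codeFP_smulL.comp (hsg.pair hc) :)
  exact (codeFP_addL.comp (hy.pair hs)).congr fun _ => rfl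

end Codes

end SamplerArithFP

end Regev2009

end Literature.Computability.Cryptography

end
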